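import Mathlib
import HarnessLib
import Literature.Analysis.FluidPDE.VectorCalculus
import Literature.Analysis.FluidPDE.VorticityCalculus
import Summits.NavierStokesRegularity.NavierStokesRegularity.Theorems.UnthreadedDoorAntidynamoEvenRungCentre
import Summits.NavierStokesRegularity.NavierStokesRegularity.Theorems.UnthreadedDoorAntidynamoSingleDegreeRungGradientBranch
import Summits.NavierStokesRegularity.NavierStokesRegularity.Theorems.UnthreadedDoorAntidynamoVorticityStructure

/-!
# Route `UnthreadedDoor` / `ThreadingFlux`, crux `PoloidalLiouville` (stmt-NavierStokesRegularity-1222), antidynamo v2 skeleton,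
# rung `stub_singleDegreeRung` — ★ THE CENTRE VALUE: the vorticity of a single-degree slice VANISHES AT THE CENTRE, and `ĝ(r)·r^l → 0`

Support file (census instrument decomp-ns-census-1 g33, cell decomp-ns; `--supports stmt-NavierStokesRegularity-1222 --as helper`; 0 kit).

The centre package (p811643, `singleDegree_vorticity_structure_centre`) bounds the amplitude, `|ĝ(r)|·r^l ≤ C` on `(0,1)`; this file
sharpens the bound to a LIMIT and evaluates the vorticity at the centre, by the same tangency trick as case (II) of the translation-rigidity
lemma (p812530):

* `centreValue_eq_zero` (pure) — `Λ` positively homogeneous of degree `l`, TANGENT (`⟪y, Λ y⟫ = 0`), `Λ ξ ≠ 0` for a unit `ξ`; `w` continuous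
  at `x₀` with `w x = G(‖x − x₀‖) • Λ(x − x₀)` off `x₀` ⟹ `w x₀ = 0` AND `G(r)·r^l → 0` as `r → 0⁺`.  Proof: along the ray `ξ`,
  `G(r) r^l → L := ⟪w x₀, Λ ξ⟫/‖Λ ξ‖²`; along every unit `u`, `w x₀ = L • Λ u`; tangency gives `⟪u, w x₀⟫ = 0` for every unit `u`, hence
  `w x₀ = 0`, hence `L • Λ ξ = 0`, `L = 0`.  (No hairy-ball theorem, no harmonicity.)
* ★ `singleDegree_curl_centre_eq_zero` — UNDER THE RUNG'S VERBATIM HYPOTHESES (any degree `l ≥ 2`, any profile; `P = 0` is the gradient branch):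
  `curl (v t) x₀ = 0` for every `t < 0`.
* ★ `vortAmp_mul_pow_tendsto_zero` — `P ≠ 0`: every amplitude `ĝ` representing `curl (v t)` off `x₀` satisfies `ĝ(r)·r^l → 0` (`r → 0⁺`).

MEANING (with p812603 `evenRung_odd_of_not_const`): a NON-constant even-degree slice has at its centre a STAGNATION POINT OF ZERO VORTICITY about
which it is odd — the zeroth-order compatibility at the centre that the (E1) assembly's removable-singularity analysis starts from.  The rung for
stagnant non-zonal even slices, the WALL `stub_scalarLiouville`, `PoloidalLiouville` (1222) and Navier–Stokes regularity are NOT touched (crux 1222 is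
INCOMPARABLE with the summit; descent inside the door's cone, decorative for the summit).  Nothing here proves NavierStokesRegularity. [folklore]
-/

noncomputable section

-- the summit and its single sub-problem share the name (CONVENTIONS §1), as in every Theorems file
set_option linter.dupNamespace false

open scoped Topology InnerProductSpace RealInnerProductSpace ContDiff
open Filter Set Metric MeasureTheory MvPolynomial
open Literature.Analysis.FluidPDE

namespace Summit.NavierStokesRegularity.NavierStokesRegularity.Theorems.PoloidalLiouville.Antidynamo

/-! ### Pure lemma: the centre value of a continuous single-degree field -/

/-- **THE CENTRE VALUE OF A CONTINUOUS SINGLE-DEGREE FIELD IS ZERO, AND `G(r) r^l → 0`.**  See the module docstring. [folklore] -/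
theorem centreValue_eq_zero {Λ w : EuclideanSpace ℝ (Fin 3) → EuclideanSpace ℝ (Fin 3)} {l : ℕ}
    (hhom : ∀ r : ℝ, 0 < r → ∀ y : EuclideanSpace ℝ (Fin 3), Λ (r • y) = r ^ l • Λ y)
    (htan : ∀ y : EuclideanSpace ℝ (Fin 3), ⟪y, Λ y⟫ = 0)
    {ξ : EuclideanSpace ℝ (Fin 3)} (hξ1 : ‖ξ‖ = 1) (hξ : Λ ξ ≠ 0)
    {x₀ : EuclideanSpace ℝ (Fin 3)} (hw : ContinuousAt w x₀) {G : ℝ → ℝ}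
    (hrep : ∀ x, x ≠ x₀ → w x = G ‖x - x₀‖ • Λ (x - x₀)) :
    w x₀ = 0 ∧ Tendsto (fun r : ℝ => G r * r ^ l) (𝓝[>] 0) (𝓝 0) := by
  -- along a unit ray: `w (x₀ + r u) = (G r * r ^ l) • Λ u` for `r > 0`, and `w (x₀ + r u) → w x₀`
  have hray : ∀ u : EuclideanSpace ℝ (Fin 3), ‖u‖ = 1 → ∀ r : ℝ, 0 < r → w (x₀ + r • u) = (G r * r ^ l) • Λ u := by
    intro u hu r hr
    have hu0 : u ≠ 0 := by
      intro h; rw [h, norm_zero] at hu; exact zero_ne_one hu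
    have hn : ‖r • u‖ = r := by rw [norm_smul, Real.norm_eq_abs, abs_of_pos hr, hu, mul_one]
    have hx : x₀ + r • u ≠ x₀ := by
      intro h
      have h' : r • u = 0 := by simpa using h
      exact smul_ne_zero hr.ne' hu0 h'
    rw [hrep _ hx, add_sub_cancel_left, hn, hhom r hr u, smul_smul]
  have hlim : ∀ u : EuclideanSpace ℝ (Fin 3), ‖u‖ = 1 →
      Tendsto (fun r : ℝ => (G r * r ^ l) • Λ u) (𝓝[>] 0) (𝓝 (w x₀)) := by
    intro u hu
    have hc : Tendsto (fun r : ℝ => x₀ + r • u) (𝓝 0) (𝓝 x₀) := by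
      have hcont : Continuous fun r : ℝ => x₀ + r • u := continuous_const.add (continuous_id.smul continuous_const)
      have h := hcont.tendsto (0 : ℝ)
      rwa [zero_smul, add_zero] at h
    have h1 : Tendsto (fun r : ℝ => w (x₀ + r • u)) (𝓝[>] 0) (𝓝 (w x₀)) :=
      (hw.tendsto.comp hc).mono_left nhdsWithin_le_nhds
    refine h1.congr' ?_
    exact eventually_nhdsWithin_of_forall fun r hr => hray u hu r hr
  -- the scalar limit along `ξ`
  have hΛpos : 0 < ‖Λ ξ‖ := norm_pos_iff.mpr hξ
  set L : ℝ := ⟪w x₀, Λ ξ⟫ / ‖Λ ξ‖ ^ 2 with hL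
  have hscal : Tendsto (fun r : ℝ => G r * r ^ l) (𝓝[>] 0) (𝓝 L) := by
    have h1 := Filter.Tendsto.inner (𝕜 := ℝ) (hlim ξ hξ1) (tendsto_const_nhds (x := Λ ξ))
    -- `h1 : ⟪(G r r^l) • Λ ξ, Λ ξ⟫ → ⟪w x₀, Λ ξ⟫`
    have h2 : Tendsto (fun r : ℝ => ⟪(G r * r ^ l) • Λ ξ, Λ ξ⟫ / ‖Λ ξ‖ ^ 2) (𝓝[>] 0) (𝓝 L) := h1.div_const _
    refine h2.congr' (Eventually.of_forall fun r => ?_)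
    rw [real_inner_smul_left, real_inner_self_eq_norm_sq]
    field_simp
  -- hence `w x₀ = L • Λ u` for every unit `u`
  have hwx : ∀ u : EuclideanSpace ℝ (Fin 3), ‖u‖ = 1 → w x₀ = L • Λ u := fun u hu =>
    tendsto_nhds_unique (hlim u hu) (hscal.smul_const (Λ u))
  -- tangency: `w x₀ = 0`
  have hw0 : w x₀ = 0 := by
    by_contra hne
    have hpos : 0 < ‖w x₀‖ := norm_pos_iff.mpr hne
    set u : EuclideanSpace ℝ (Fin 3) := ‖w x₀‖⁻¹ • w x₀ with hu
    have hu1 : ‖u‖ = 1 := by rw [hu, norm_smul, norm_inv, norm_norm, inv_mul_cancel₀ hpos.ne']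
    have h2 : ⟪u, w x₀⟫ = 0 := by
      rw [hwx u hu1, real_inner_smul_right, htan u, mul_zero]
    rw [hu, real_inner_smul_left, real_inner_self_eq_norm_sq] at h2
    have : ‖w x₀‖⁻¹ * ‖w x₀‖ ^ 2 = ‖w x₀‖ := by field_simp
    rw [this] at h2
    exact hpos.ne' h2
  refine ⟨hw0, ?_⟩
  have hL0 : L = 0 := by
    have h := hwx ξ hξ1
    rw [hw0, eq_comm, smul_eq_zero] at h
    exact h.resolve_right hξ
  rw [hL0] at hscal
  exact hscal

/-! ### ★ The rung's letter: vorticity vanishes at the centre -/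

/-- ★ **THE VORTICITY OF A SINGLE-DEGREE SLICE VANISHES AT THE CENTRE.**  Under the rung's VERBATIM hypotheses (any degree `l ≥ 2`, any
harmonic homogeneous profile `P`; `P = 0`: the slice is a gradient, hence constant, hence curl-free), `curl (v t) x₀ = 0` for every `t < 0`.
[folklore] -/
theorem singleDegree_curl_centre_eq_zero
    (v : ℝ → EuclideanSpace ℝ (Fin 3) → EuclideanSpace ℝ (Fin 3)) (x₀ : EuclideanSpace ℝ (Fin 3))
    (hB : Literature.Analysis.FluidPDE.IsBoundedAncientMildSolution 1 v)
    (hm : ∀ t < 0, AEStronglyMeasurable (v t) volume)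
    (hsm : ContDiffOn ℝ (⊤ : ℕ∞) (Function.uncurry v) (Set.Iio 0 ×ˢ Set.univ))
    {l : ℕ} {P : MvPolynomial (Fin 3) ℝ} (hl : 2 ≤ l) (hP : P.IsHomogeneous l)
    (hharm : ∀ y : EuclideanSpace ℝ (Fin 3),
      Laplacian.laplacian (fun z : EuclideanSpace ℝ (Fin 3) => MvPolynomial.eval (fun i => z i) P) y = 0)
    (hrep : ∀ t < 0, ∃ (g : ℝ → ℝ) (φ : EuclideanSpace ℝ (Fin 3) → ℝ), ∀ x,
      v t x = gradient φ x + (g ‖x - x₀‖ * MvPolynomial.eval (fun i => (x - x₀) i) P) • (x - x₀)) :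
    ∀ t < 0, curl (v t) x₀ = 0 := by
  intro t ht
  by_cases hP0 : P = 0
  · -- gradient branch: the slice is constant
    obtain ⟨b, hb⟩ := constant_of_forall_gradient_slices v hB hsm (fun s hs => by
      obtain ⟨g, φ, hv⟩ := hrep s hs
      exact ⟨φ, fun x => by rw [hv x, hP0, map_zero, mul_zero, zero_smul, add_zero]⟩) t ht
    have hconst : v t = fun _ => b := funext hb
    rw [hconst]
    exact curl_eq_zero_of_fderiv_eq_zero (by simp)
  · obtain ⟨ĝ, -, hcurl, -, -⟩ := singleDegree_vorticity_structure_centre v x₀ hB hm hsm hl hP hP0 hharm hrep t ht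
    set Q : EuclideanSpace ℝ (Fin 3) → ℝ := fun z => MvPolynomial.eval (fun i => z i) P with hQ
    have hQω : ContDiff ℝ ω Q := contDiff_omega_evalPoly P
    have hQhom : ∀ r : ℝ, 0 < r → ∀ y : EuclideanSpace ℝ (Fin 3), Q (r • y) = r ^ l * Q y :=
      fun r _ y => evalPoly_smul hP r y
    have hl1 : 1 ≤ l := by omega
    have hQne : ∃ y, Q y ≠ 0 := exists_evalPoly_ne_zero hP0
    obtain ⟨ξ, hξ1, hξ⟩ := exists_unit_cross_gradient_ne_zero hQω hl1 hQhom hharm hQne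
    have hΛhom : ∀ r : ℝ, 0 < r → ∀ y : EuclideanSpace ℝ (Fin 3),
        cross (gradient Q (r • y)) (r • y) = r ^ l • cross (gradient Q y) y :=
      fun r hr y => cross_gradient_smul_of_homogeneous (hQω.differentiable (by simp)) hQhom hr y
    have htan : ∀ y : EuclideanSpace ℝ (Fin 3), ⟪y, cross (gradient Q y) y⟫ = 0 := by
      intro y
      simp only [cross, PiLp.inner_apply, cross_apply, RCLike.inner_apply, conj_trivial, Fin.sum_univ_three,
        Matrix.cons_val_zero, Matrix.cons_val_one, Matrix.cons_val_two, Matrix.head_cons, Matrix.tail_cons]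
      ring
    have hsm' : IsSmoothSpaceTimeOn (Iio 0) v := hsm
    have hv1 : ContDiff ℝ 1 (v t) := (hsm'.contDiff_slice ht).of_le (by norm_cast)
    have hwc : Continuous (curl (v t)) := continuous_curl hv1
    exact (centreValue_eq_zero (Λ := fun y => cross (gradient Q y) y) hΛhom htan hξ1 hξ hwc.continuousAt hcurl).1

/-- ★ **THE AMPLITUDE IS `o(r^{−l})` AT THE CENTRE.**  Under the rung's VERBATIM hypotheses with `P ≠ 0`, every amplitude `ĝ` representing
`curl (v t)` off `x₀` satisfies `ĝ(r)·r^l → 0` as `r → 0⁺` (sharpening the centre bound `|ĝ(r)|·r^l ≤ C` of p811643). [folklore] -/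
theorem vortAmp_mul_pow_tendsto_zero
    (v : ℝ → EuclideanSpace ℝ (Fin 3) → EuclideanSpace ℝ (Fin 3)) (x₀ : EuclideanSpace ℝ (Fin 3))
    (hsm : ContDiffOn ℝ (⊤ : ℕ∞) (Function.uncurry v) (Set.Iio 0 ×ˢ Set.univ))
    {l : ℕ} {P : MvPolynomial (Fin 3) ℝ} (hl : 2 ≤ l) (hP : P.IsHomogeneous l) (hP0 : P ≠ 0)
    (hharm : ∀ y : EuclideanSpace ℝ (Fin 3),
      Laplacian.laplacian (fun z : EuclideanSpace ℝ (Fin 3) => MvPolynomial.eval (fun i => z i) P) y = 0)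
    {t : ℝ} (ht : t < 0) {ĝ : ℝ → ℝ}
    (hcurl : ∀ x : EuclideanSpace ℝ (Fin 3), x ≠ x₀ →
      curl (v t) x = ĝ ‖x - x₀‖ •
        cross (gradient (fun z : EuclideanSpace ℝ (Fin 3) => MvPolynomial.eval (fun i => z i) P) (x - x₀)) (x - x₀)) :
    Tendsto (fun r : ℝ => ĝ r * r ^ l) (𝓝[>] 0) (𝓝 0) := by
  set Q : EuclideanSpace ℝ (Fin 3) → ℝ := fun z => MvPolynomial.eval (fun i => z i) P with hQ
  have hQω : ContDiff ℝ ω Q := contDiff_omega_evalPoly P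
  have hQhom : ∀ r : ℝ, 0 < r → ∀ y : EuclideanSpace ℝ (Fin 3), Q (r • y) = r ^ l * Q y :=
    fun r _ y => evalPoly_smul hP r y
  have hl1 : 1 ≤ l := by omega
  have hQne : ∃ y, Q y ≠ 0 := exists_evalPoly_ne_zero hP0
  obtain ⟨ξ, hξ1, hξ⟩ := exists_unit_cross_gradient_ne_zero hQω hl1 hQhom hharm hQne
  have hΛhom : ∀ r : ℝ, 0 < r → ∀ y : EuclideanSpace ℝ (Fin 3),
      cross (gradient Q (r • y)) (r • y) = r ^ l • cross (gradient Q y) y :=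
    fun r hr y => cross_gradient_smul_of_homogeneous (hQω.differentiable (by simp)) hQhom hr y
  have htan : ∀ y : EuclideanSpace ℝ (Fin 3), ⟪y, cross (gradient Q y) y⟫ = 0 := by
    intro y
    simp only [cross, PiLp.inner_apply, cross_apply, RCLike.inner_apply, conj_trivial, Fin.sum_univ_three,
      Matrix.cons_val_zero, Matrix.cons_val_one, Matrix.cons_val_two, Matrix.head_cons, Matrix.tail_cons]
    ring
  have hsm' : IsSmoothSpaceTimeOn (Iio 0) v := hsm
  have hv1 : ContDiff ℝ 1 (v t) := (hsm'.contDiff_slice ht).of_le (by norm_cast)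
  have hwc : Continuous (curl (v t)) := continuous_curl hv1
  exact (centreValue_eq_zero (Λ := fun y => cross (gradient Q y) y) hΛhom htan hξ1 hξ hwc.continuousAt hcurl).2

end Summit.NavierStokesRegularity.NavierStokesRegularity.Theorems.PoloidalLiouville.Antidynamo

end
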